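import Summits.AtomisticToContinuum.Crystallization.Theorems.OverbindingBudgetElasticSplitLocalVirial
import Summits.AtomisticToContinuum.Crystallization.Theorems.OverbindingBudgetImprovementTransfer

/-!
# OverbindingBudget — the RDEF cone of record with `LocalRelaxationTest` DISCHARGED (lens-4 g28)

`LocalRelaxationTest (1/250) 10` is a tree theorem (`localRelaxationTest_record`, parts I–IV of the local relaxation test), so the
record cone `rdef_of_grossU_shearSplit_record` of `RobustDefectLimitWindows` (stmt-AtomisticToContinuum-31280) shortens to
`GrossCleanBallsU (1/250) 10 → ChargedEnergyGap → CompressedVirialLaw (1/250) 10 → ShearFreeLiouvilleLaw (1/250) 10 → CleanlessExcessT →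
CoherentResidual 10 → RobustDefectLimitWindows`, and the finer cone `rdef_of_grossU_localVirial_record` (EOS branch as the per-site virial
certificate `LocalVirialLaw`) to `GrossCleanBallsU (1/250) 10 → ChargedEnergyGap → LocalVirialLaw (1/250) 10 → ShearFreeLiouvilleLaw (1/250) 10 →
CleanlessExcessT → CoherentResidual 10 → RobustDefectLimitWindows`.
-/

namespace Summit.AtomisticToContinuum.Crystallization.Theorems.OverbindingBudgetElasticSplitRelaxed

open Summit.AtomisticToContinuum.Crystallization.Theses.OverbindingBudget (RobustDefectLimitWindows)
open Summit.AtomisticToContinuum.Crystallization.Theses.PricedLinkCensus (ChargedEnergyGap)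
open Summit.AtomisticToContinuum.Crystallization.Theorems.OverbindingBudgetGradedBareness (CleanlessExcessT)
open Summit.AtomisticToContinuum.Crystallization.Theorems.OverbindingBudgetCoherentCut (CoherentResidual)
open Summit.AtomisticToContinuum.Crystallization.Theorems.OverbindingBudgetUniformCutStatements (GrossCleanBallsU)
open Summit.AtomisticToContinuum.Crystallization.Theorems.OverbindingBudgetElasticSplitScale (CompressedVirialLaw)
open Summit.AtomisticToContinuum.Crystallization.Theorems.OverbindingBudgetElasticSplitShear (ShearFreeLiouvilleLaw rdef_of_grossU_shearSplit_record)
open Summit.AtomisticToContinuum.Crystallization.Theorems.OverbindingBudgetElasticSplitLocalVirial (LocalVirialLaw rdef_of_grossU_localVirial_record)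
open Summit.AtomisticToContinuum.Crystallization.Theorems.OverbindingBudgetImprovementTransfer (localRelaxationTest_record)

/-- **RDEF cone of record, relaxed**: `GrossCleanBallsU (1/250) 10 → ChargedEnergyGap → CompressedVirialLaw (1/250) 10 →
ShearFreeLiouvilleLaw (1/250) 10 → CleanlessExcessT → CoherentResidual 10 → RobustDefectLimitWindows` (the local relaxation test is
now proved: `localRelaxationTest_record`). -/
theorem rdef_of_grossU_shearSplit_relaxed (hG : GrossCleanBallsU (1 / 250) 10) (hCEG : ChargedEnergyGap)
    (hC : CompressedVirialLaw (1 / 250) 10) (hS : ShearFreeLiouvilleLaw (1 / 250) 10) (hCE : CleanlessExcessT) (hR : CoherentResidual 10) :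
    RobustDefectLimitWindows :=
  rdef_of_grossU_shearSplit_record hG hCEG localRelaxationTest_record hC hS hCE hR

/-- **The finer RDEF cone of record, relaxed** (EOS branch as the per-site virial certificate): `GrossCleanBallsU (1/250) 10 → ChargedEnergyGap →
LocalVirialLaw (1/250) 10 → ShearFreeLiouvilleLaw (1/250) 10 → CleanlessExcessT → CoherentResidual 10 → RobustDefectLimitWindows`. -/
theorem rdef_of_grossU_localVirial_relaxed (hG : GrossCleanBallsU (1 / 250) 10) (hCEG : ChargedEnergyGap)
    (hV : LocalVirialLaw (1 / 250) 10) (hS : ShearFreeLiouvilleLaw (1 / 250) 10) (hCE : CleanlessExcessT) (hR : CoherentResidual 10) :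
    RobustDefectLimitWindows :=
  rdef_of_grossU_localVirial_record hG hCEG localRelaxationTest_record hV hS hCE hR

end Summit.AtomisticToContinuum.Crystallization.Theorems.OverbindingBudgetElasticSplitRelaxed
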